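import Summits.Ventures.PackingBounds.Energy.FivePointRieszEightGramDataL1
import Summits.Ventures.PackingBounds.Energy.FivePointRieszEightGramDataL2
import HarnessLib

/-!
# Integer Gram data `S·Y = L Lᵀ + E` (the rows of L: the table (collector of 2 part modules)) of the 158 × 158 SOS block of the exact sharp three-point certificate
# `e3pt-sharp-n3N5s8d8-none.json` (triangular bipyramid; five points on S², single SOS term, d = 8)

Framing: lottery ticket; floor = certified bounds/negative ranges. Venture `PackingBounds`, cell `pub-packcert`, energy family E3PT
(pub-packcert-energy gen 15; KERNEL-D6 data route). `yR8` = S·Y (S = `scaleR8` = lcm of denominators · 2^40), `lR8` = rounded scaled Cholesky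
factor, `eR8` = S·Y − lR8·lR8ᵀ (exact; symmetric, diagonally dominant). Checked by `decide +kernel` with `GramData.checkRows` / `checkDD`
in `FivePointRieszEightGramFacts*`; generator `pub-packcert-energy/code/e3pt/g17/e3pt_lean_n3x.py`. (Rows split in independent modules for the gate's request-size limit; one collector per table.)
-/

namespace Summit.Ventures.PackingBounds.Energy.RieszEightD8

/-- data rows. -/
def lR8 : List (List ℤ) := [lR80, lR81, lR82, lR83, lR84, lR85, lR86, lR87, lR88, lR89, lR810, lR811, lR812, lR813, lR814, lR815, lR816, lR817, lR818, lR819, lR820, lR821, lR822, lR823, lR824, lR825, lR826, lR827, lR828, lR829, lR830, lR831, lR832, lR833, lR834, lR835, lR836, lR837, lR838, lR839, lR840, lR841, lR842, lR843, lR844, lR845, lR846, lR847, lR848, lR849, lR850, lR851, lR852, lR853, lR854, lR855, lR856, lR857, lR858, lR859, lR860, lR861, lR862, lR863, lR864, lR865, lR866, lR867, lR868, lR869, lR870, lR871, lR872, lR873, lR874, lR875, lR876, lR877, lR878, lR879, lR880, lR881, lR882, lR883, lR884, lR885, lR886, lR887, lR888, lR889, lR890, lR891, lR892, lR893, lR894,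 lR895, lR896, lR897, lR898, lR899, lR8100, lR8101, lR8102, lR8103, lR8104, lR8105, lR8106, lR8107, lR8108, lR8109, lR8110, lR8111, lR8112, lR8113, lR8114, lR8115, lR8116, lR8117, lR8118, lR8119, lR8120, lR8121, lR8122, lR8123, lR8124, lR8125, lR8126, lR8127, lR8128, lR8129, lR8130, lR8131, lR8132, lR8133, lR8134, lR8135, lR8136, lR8137, lR8138, lR8139, lR8140, lR8141, lR8142, lR8143, lR8144, lR8145, lR8146, lR8147, lR8148, lR8149, lR8150, lR8151, lR8152, lR8153, lR8154, lR8155, lR8156, lR8157]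

end Summit.Ventures.PackingBounds.Energy.RieszEightD8
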